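import Summits.CriticalPhenomena.CardyFormulaZ2.Theorems.CardyMagicRigidityNestingRigidityFourArmCouplingTQuenched
import Summits.CriticalPhenomena.CardyFormulaZ2.Theorems.CardyMagicRigidityNestingRigidityPinchLocality
import HarnessLib

/-!
# Conditioning on the exterior by the product formula: `P(E ∩ F) = ∫_F P_ξ[(ξ ∩ K) ∪ (ω ∖ K) ∈ E] dP(ω)`

Crux `Summit.CriticalPhenomena.CardyFormulaZ2.Theses.CardyMagicRigidity.NestingRigidity`
(stmt-CriticalPhenomena-4835), line `pinch-resampling` v3, helper of the transfer stub S10 `stub_neckTomography`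
(identification step, audit `S4-audit.md` §3 (ii.1) / §4 (iii.2)): conditionally on the FULL exterior of a neck region,
the hook-up bit of the region is Bernoulli with parameter the PRODUCT-FORMULA conditional probability
`g(ω) = P_ξ[(ξ ∩ K) ∪ (ω ∖ K) ∈ Hook]` (fresh sample `ξ` on the interior coordinates `K`, `ω` kept off `K`).  This file
proves that `g` IS a version of the conditional probability given the exterior σ-algebra, in the form the identification
consumes: for every exterior event `F` (measurable, `DeterminedBy F Kᶜ`), `P(E ∩ F) = ∫ 1_F · g dP`.

* §1 generic, for `sitePercolation V p` and an event `E` reading the coordinates `K ∪ R` with `R` a FINITE "ring" disjoint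
  from `K` (`measureReal_inter_eq_integral_splice`, registered anchor).  Proof by finite summation over the cylinders
  `C_ζ` of the ring (`measureReal_eq_sum_inter_localCylinder`): on `C_ζ` the function `g` is the constant
  `g_ζ = P(E_ζ)`, `E_ζ = {ω | (ω ∩ K) ∪ (ζ ∖ K) ∈ E}` an interior event with `E ∩ C_ζ = E_ζ ∩ C_ζ`, so
  `P(E ∩ C_ζ) = g_ζ P(C_ζ)` (`measureReal_inter_of_determinedBy`), while exterior events weight cylinders,
  `P(E ∩ F ∩ C_ζ) = P(F_ζ) P(E ∩ C_ζ)` and `P(F ∩ C_ζ) = P(F_ζ) P(C_ζ)` (`measureReal_inter_inter_localCylinder`); both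
  sides equal `Σ_ζ P(F_ζ) P(C_ζ) g_ζ`.
* §2 the site-`𝕋` instance for the hook-up of the ball `Λ_s(x)` with its collar: `E = THook x x s s` reads `Λ_{2s}(x)`
  (`tHook_determinedBy`), `K = tBall x s`, ring `Λ_{2s}(x) ∖ Λ_s(x)` (`real_tHook_inter_eq_integral_splice`); this is the
  defining property of `tHookProb x s ω := P.real {ξ | ξ ∩ tBall x s ∪ ω \ tBall x s ∈ THook x x s s}` of the S10 typing note.
-/

noncomputable section

namespace Summit.CriticalPhenomena.CardyFormulaZ2.Cruxes.NestingRigidity.PinchResampling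

open MeasureTheory Set Literature.Probability.Percolation Literature.Probability.LatticeModels

/-! ## §1 The product formula is the conditional probability given the exterior (finite ring) -/

section Generic

variable {V : Type*}

/-- Two splices `(ξ ∩ K) ∪ (ω ∖ K)`, `(ξ ∩ K) ∪ (ζ ∖ K)` agree on `K ∪ R` as soon as `ω` and `ζ` agree on `R`. -/
theorem splice_inter_union_eq_of_agree {K R ω ζ : Set V} (ξ : Set V) (h : ∀ i ∈ R, (i ∈ ω ↔ i ∈ ζ)) :
    (ξ ∩ K ∪ ω \ K) ∩ (K ∪ R) = (ξ ∩ K ∪ ζ \ K) ∩ (K ∪ R) := by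
  ext i
  simp only [mem_inter_iff, mem_union, mem_sdiff]
  by_cases hiR : i ∈ R
  · rw [h i hiR]
  · by_cases hiK : i ∈ K <;> simp [hiK, hiR]

/-- The interior section `E_ζ = {ω | (ω ∩ K) ∪ (ζ ∖ K) ∈ E}` is determined by `K`. -/
theorem determinedBy_interiorSection (E : Set (Set V)) (K ζ : Set V) :
    DeterminedBy {ω | ω ∩ K ∪ ζ \ K ∈ E} K := by
  rw [determinedBy_iff]
  intro ω ω' h
  simp only [mem_setOf_eq, h]

/-- The interior section of a measurable event is measurable. -/
theorem measurableSet_interiorSection {E : Set (Set V)} (hE : MeasurableSet E) (K ζ : Set V) :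
    MeasurableSet {ω | ω ∩ K ∪ ζ \ K ∈ E} := by
  have h : (fun ω : Set V ↦ ω ∩ K ∪ ζ \ K) = fun ω ↦ ω \ Kᶜ ∪ ζ ∩ Kᶜ := by
    funext ω; rw [sdiff_compl, ← sdiff_eq]
  change MeasurableSet ((fun ω : Set V ↦ ω ∩ K ∪ ζ \ K) ⁻¹' E)
  rw [h]
  exact hE.preimage (measurable_splice Kᶜ ζ)

/-- **`P(E ∩ F) = ∫_F P_ξ[(ξ ∩ K) ∪ (ω ∖ K) ∈ E] dP(ω)` (registered anchor).**  For the product measure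
`sitePercolation V p`, interior coordinates `K`, a finite ring `R` disjoint from `K`, an event `E` determined by
`K ∪ R` and an EXTERIOR event `F` (measurable, determined by `Kᶜ`): the probability of `E ∩ F` is the integral over `F`
of the product-formula conditional probability `ω ↦ P{ξ | (ξ ∩ K) ∪ (ω ∖ K) ∈ E}` — i.e. the latter is a version of
`P[E | σ(exterior)]`, defined at every `ω`.  (Finite sum over the ring cylinders; see the module docstring.) -/
theorem measureReal_inter_eq_integral_splice : ∀ {V : Type*} (p : unitInterval) {K : Set V} {R : Finset V}, Disjoint K ↑R → ∀ {E F : Set (Literature.Probability.Percolation.SiteConfig V)}, MeasurableSet E → MeasurableSet F → Literature.Probability.Percolation.DeterminedBy E (K ∪ ↑R) → Literature.Probability.Percolation.DeterminedBy F Kᶜ → (Literature.Probability.Percolation.sitePercolation V p).real (E ∩ F) = ∫ ω, F.indicator 1 ω * (Literature.Probability.Percolation.sitePercolation V p).real {ξ | ξ ∩ K ∪ ω \ K ∈ E} ∂(Literature.Probability.Percolation.sitePercolation V p) := by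
  intro V p K R hKR E F hEm hFm hE hF
  classical
  set μ := sitePercolation V p with hμ
  -- the cylinders of the ring and the constants `g_ζ`
  set C : Finset V → Set (Set V) := fun ζ ↦ localCylinder (↑R : Set V) (↑ζ : Set V) with hC
  set g : Set V → ℝ := fun ω ↦ μ.real {ξ | ξ ∩ K ∪ ω \ K ∈ E} with hg
  set Fsec : Finset V → Set (Set V) := fun ζ ↦ {ω | ω \ ↑R ∪ (↑ζ : Set V) ∩ ↑R ∈ F} with hFsec
  have hCm : ∀ ζ, MeasurableSet (C ζ) := fun ζ ↦ measurableSet_localCylinder R.countable_toSet _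
  -- (A) `g` is constant on each cylinder
  have hgC : ∀ ζ : Finset V, ∀ ω ∈ C ζ, g ω = g ↑ζ := by
    intro ζ ω hω
    simp only [hg]
    congr 1
    ext ξ
    exact (determinedBy_iff E _).1 hE _ _ (splice_inter_union_eq_of_agree ξ hω)
  -- (B) `P(E ∩ C_ζ) = g_ζ P(C_ζ)`
  have hEC : ∀ ζ : Finset V, μ.real (E ∩ C ζ) = g ↑ζ * μ.real (C ζ) := by
    intro ζ
    have hset : E ∩ C ζ = {ω | ω ∩ K ∪ (↑ζ : Set V) \ K ∈ E} ∩ C ζ := by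
      ext ω
      simp only [mem_inter_iff, mem_setOf_eq, and_congr_left_iff]
      intro hω
      refine (determinedBy_iff E _).1 hE _ _ ?_
      have h := splice_inter_union_eq_of_agree (K := K) ω hω
      rwa [inter_union_sdiff] at h
    rw [hset]
    exact measureReal_inter_of_determinedBy p hKR (measurableSet_interiorSection hEm K _) (hCm ζ)
      (determinedBy_interiorSection E K _) (determinedBy_localCylinder _ _)
  -- (C) exterior events weight the cylinders
  have hdisj : Disjoint ((K ∪ ↑R) \ ↑R) Kᶜ :=
    disjoint_compl_right.mono_left (sdiff_subset_iff.2 (union_comm _ _).subset)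
  have hEFC : ∀ ζ : Finset V, μ.real (E ∩ F ∩ C ζ) = μ.real (Fsec ζ) * μ.real (E ∩ C ζ) := fun ζ ↦
    measureReal_inter_inter_localCylinder p R.countable_toSet hdisj hEm hFm hE hF _
  have hFC : ∀ ζ : Finset V, μ.real (F ∩ C ζ) = μ.real (Fsec ζ) * μ.real (C ζ) := by
    intro ζ
    have h := measureReal_inter_inter_localCylinder p R.countable_toSet hdisj MeasurableSet.univ hFm
      (determinedBy_univ _) hF (↑ζ : Set V)
    rwa [univ_inter, univ_inter] at h
  -- (D) the left-hand side as a sum over cylinders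
  have hL : μ.real (E ∩ F) = ∑ ζ ∈ R.powerset, μ.real (Fsec ζ) * (g ↑ζ * μ.real (C ζ)) := by
    rw [measureReal_eq_sum_inter_localCylinder μ R (hEm.inter hFm)]
    exact Finset.sum_congr rfl fun ζ _ ↦ by rw [hEFC, hEC]
  -- (D') the integrand as a finite combination of indicators
  have hpt : ∀ ω : Set V, F.indicator (1 : Set V → ℝ) ω * g ω =
      ∑ ζ ∈ R.powerset, (F ∩ C ζ).indicator (fun _ ↦ g ↑ζ) ω := by
    intro ω
    set ζ₀ : Finset V := R.filter (· ∈ ω) with hζ₀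
    have hζ₀C : ω ∈ C ζ₀ := fun i hi ↦ by simp [hζ₀, Finset.mem_coe.1 hi]
    have huniq : ∀ ζ ∈ R.powerset, ω ∈ C ζ → ζ = ζ₀ := by
      intro ζ hζ hω
      ext i
      simp only [hζ₀, Finset.mem_filter]
      constructor
      · intro hi
        have hiR := Finset.mem_powerset.1 hζ hi
        exact ⟨hiR, (hω i (Finset.mem_coe.2 hiR)).2 (Finset.mem_coe.2 hi)⟩
      · rintro ⟨hiR, hiω⟩
        exact Finset.mem_coe.1 ((hω i (Finset.mem_coe.2 hiR)).1 hiω)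
    rw [Finset.sum_eq_single ζ₀ (fun ζ hζ hne ↦ ?_) (fun h ↦ ?_)]
    · rw [hgC ζ₀ ω hζ₀C]
      by_cases hωF : ω ∈ F
      · rw [indicator_of_mem hωF, indicator_of_mem (mem_inter hωF hζ₀C)]; simp
      · rw [indicator_of_notMem hωF, indicator_of_notMem fun h ↦ hωF h.1]; simp
    · exact indicator_of_notMem (fun h ↦ hne (huniq ζ hζ h.2)) _
    · exact absurd (Finset.mem_powerset.2 (Finset.filter_subset _ _)) h
  -- (E) integrate
  have hR' : ∫ ω, F.indicator (1 : Set V → ℝ) ω * g ω ∂μ =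
      ∑ ζ ∈ R.powerset, μ.real (F ∩ C ζ) * g ↑ζ := by
    have hint : ∀ ζ ∈ R.powerset, Integrable (fun ω ↦ (F ∩ C ζ).indicator (fun _ ↦ g (↑ζ : Set V)) ω) μ :=
      fun ζ _ ↦ (integrable_const (g (↑ζ : Set V))).indicator (hFm.inter (hCm ζ))
    rw [integral_congr_ae (Filter.Eventually.of_forall hpt), integral_finsetSum _ hint]
    exact Finset.sum_congr rfl fun ζ _ ↦ by rw [integral_indicator_const _ (hFm.inter (hCm ζ)), smul_eq_mul]
  rw [hL, hR']
  exact Finset.sum_congr rfl fun ζ _ ↦ by rw [hFC]; ring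

end Generic

/-! ## §2 Site `𝕋`: the hook-up of a ball given its exterior -/

section SiteT

/-- **The defining property of `g^𝕋_{x,s}`**: for every exterior event `F` of the ball `Λ_s(x)` (measurable, determined
by the sites off the ball), `P_{1/2}(THook x x s s ∩ F) = ∫_F P_ξ[(ξ ∩ Λ_s(x)) ∪ (ω ∖ Λ_s(x)) ∈ THook x x s s] dP(ω)`
— the product-formula hook-up probability of the ball given its exterior is a version of the conditional probability
(ring `Λ_{2s}(x) ∖ Λ_s(x)`, `tHook_determinedBy`). -/
theorem real_tHook_inter_eq_integral_splice (x : Site 2) (s : ℕ) {F : Set (SiteConfig (Site 2))}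
    (hFm : MeasurableSet F) (hF : DeterminedBy F (tBall x s)ᶜ) :
    (triSitePercolation half).real (THook x x s s ∩ F) =
      ∫ ω, F.indicator 1 ω * (triSitePercolation half).real {ξ | ξ ∩ tBall x s ∪ ω \ tBall x s ∈ THook x x s s}
        ∂(triSitePercolation half) := by
  classical
  set R : Finset (Site 2) := (tBall_finite x (2 * s)).toFinset.filter (· ∉ tBall x s) with hR
  have hRc : (↑R : Set (Site 2)) = tBall x (2 * s) \ tBall x s := by
    ext v; simp [hR]
  have hKR : Disjoint (tBall x s) ↑R := by
    rw [hRc]; exact disjoint_sdiff_right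
  have hE : DeterminedBy (THook x x s s) (tBall x s ∪ ↑R) := by
    rw [hRc, union_sdiff_self]
    exact (tHook_determinedBy x x s s).mono subset_union_right
  exact measureReal_inter_eq_integral_splice half hKR (measurableSet_tHook x x s s) hFm hE hF

end SiteT

end Summit.CriticalPhenomena.CardyFormulaZ2.Cruxes.NestingRigidity.PinchResampling

end
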